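import Summits.BirchSwinnertonDyer.BirchSwinnertonDyer.Theorems.KimAtThreeDeepUpperAdditiveDefectOfPortE
import Summits.BirchSwinnertonDyer.BirchSwinnertonDyer.Theorems.KimAtThreeDeepUpperAdditiveDefectOfPortEDeep
import Summits.BirchSwinnertonDyer.BirchSwinnertonDyer.Theorems.KimAtThreeDeepUpperOffStratumWuthrich
import Summits.BirchSwinnertonDyer.BirchSwinnertonDyer.Theorems.KimAtThreeKolyvaginDefs
import HarnessLib

/-!
# Route `KimAtThreeKolyvagin` (rung W2), crux `DeepUpperAtThreeOffKatoStratum` (item 19562) BY NAME: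
# Wuthrich's bound + (DD) on the NON-additive rows, and [S24] + GZK + Poitou–Tate + ONE port family on
# the ADDITIVE-defect rows — no (U′), no (DD) at an additive `3`

Cell `bsd-addord`, seat `bsd-addord-w2-acc1` (PROGRAMME PART 1b, ACCEL-LIST l.753 row (1)), item
`stmt-BirchSwinnertonDyer-19562` (owner w2-c5; `--supports` helpers; the registered composition
`Cruxes.DeepUpperAtThreeOffKatoStratum.Birth.DeepUpperAtThreeOffKatoStratum_of` is the owner's to run —
this file re-does its five-line case split on theorems, not on stubs).  Theorems only (no definition, no
named fact, no `sorry`); the crux stays OPEN; nothing asserted about any curve; BSD is not proved.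

* ★ `deepUpperAtThreeOffKatoStratum_of_wuthrich_of_portFamily` — crux 19562 BY NAME ⟸ Wuthrich 2014
  Prop. 21 (`sha_dvd_analyticSha`), GZK, modularity, (DD) DISPLAYED on the NON-additive tower rows only
  (w2-c5's `stub_nonAdditive_of_wuthrich_of_deepInfty_le_tamagawa`), the two [S24] Thm. 4.4 facts, the
  Poitou–Tate named fact, and the port family `HPortDefect` on the additive-defect rows (this seat's
  `stub_additiveDefect_of_facts_of_portFamily`).  Versus the reading of record (w2-c5's ★
  `deepUpperAtThreeOffKatoStratum_of_wuthrich_of_kato_of_residuals`: Wuthrich + Kato 14.5 (3) + GZK +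
  hmod + (U′) + (DD) on ALL rows): on the additive rows (U′) (no printed source on pot-mult defect rows)
  and (DD) (main-conjecture strength) are REPLACED by [S24] ×2 + PT + one explicit-reciprocity port family
  — the same debt class the Kato stratum (crux 19560) already carries.
* ★ `deepUpperAtThreeOffKatoStratum_of_wuthrich_of_deepPortFamily` — the same with the DEEP-keyed port
  family `HPortDefectDeep` (n1011 (B6): honest on `E(ℚ₃)[3] ≠ 0` rows) at the price of S24-DEEP ×2.
* §2 KEYED AT acc6's REGISTERED PORT₂ `KimAtThreeKolyvaginDefs.KatoKuriharaPortThreeAtWith₂TwoExp W t e v₃ η P`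
  (the two-exponent dictionary predicate, appended 2026-08-26; ONE object for the additive-defect rows of
  19562 / 19599 / 19679): `portEDeep_of_portTwoExp` (PORT₂ + its antecedents ⟹ this seat's deep-keyed
  free-exponent port at `(t, t)`, by the scaling lemma `katoKuriharaWitnessAt_smul_of_twoExponent`),
  ★ `stub_additiveDefect_of_deepFacts_of_portTwoExp` (the registered stub VERBATIM ⟸ S24-DEEP ×2 + GZK + PT +
  PORT₂ on the stub's rows) and ★ `deepUpperAtThreeOffKatoStratum_of_wuthrich_of_portTwoExp` (the crux BY NAME).
[cite: Wuthrich2014, Prop. 21 and Lemma 20 (p. 399)] [cite: Kim2025RefinedTNC, Thm 1.1]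
[cite: Kim2022StructureSelmer, Thm. 3.13, Rem. 3.8, Conj. 1.10 (PDF p. 8)] [cite: Sakamoto2024, Thm. 4.4 (1)(2) (p. 926)]
[cite: MilneADT2006, Ch. I, Thm. 4.10] [cite: Miller2011LMS, Def. 1.1]
-/

set_option autoImplicit false
-- the Theorems namespace of a single-conjunct summit repeats the summit name by design (D-0017)
set_option linter.dupNamespace false

noncomputable section

open scoped Classical NumberField
open Function Field NumberField IsDedekindDomain IsDedekindDomain.HeightOneSpectrum WeierstrassCurve
  CongruenceSubgroup
  Literature.NumberTheory.EllipticCurves Literature.NumberTheory.EllipticCurves.ModularForms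
  Literature.NumberTheory.EllipticCurves.Rank1Residual
  Literature.NumberTheory.EllipticCurves.Rank1Residual.Typed
  Literature.NumberTheory.GaloisRepresentations
  Literature.NumberTheory.GaloisRepresentations.DiscreteGaloisModule Literature.NumberTheory.GaloisCohomology
  Summit.BirchSwinnertonDyer.Rank1Residual.GaloisImage
  Summit.BirchSwinnertonDyer.BirchSwinnertonDyer.Theses.KimAtThreeKolyvagin
  Summit.BirchSwinnertonDyer.BirchSwinnertonDyer.Theorems.KimAtThreeDeepUpperAdditiveDefectOfPortE
  Summit.BirchSwinnertonDyer.BirchSwinnertonDyer.Theorems.KimAtThreeDeepUpperAdditiveDefectOfPortEDeep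
  Summit.BirchSwinnertonDyer.BirchSwinnertonDyer.Theorems.KimAtThreeDeepUpperOffStratumWuthrich
  Summit.BirchSwinnertonDyer.BirchSwinnertonDyer.Theorems.KimAtThreeKolyvaginDefs

namespace Summit.BirchSwinnertonDyer.BirchSwinnertonDyer.Theorems.KimAtThreeDeepUpperOffStratumOfPortFamily

/-- ★ **Crux `DeepUpperAtThreeOffKatoStratum` (item 19562) BY NAME — NON-additive rows from Wuthrich's
bound modulo (DD), ADDITIVE-defect rows from [S24] ×2 + GZK + PT modulo ONE port family.**  Hypotheses:
`hW` Wuthrich 2014 Prop. 21, `hGZK`, `hmod`, `hDD` = the deep Tamagawa-defect bound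
`∂^{(∞)}_{deep}(δ̃) ≤ v₃(∏ c_ℓ)` DISPLAYED on the NON-additive rows of the crux (binders verbatim + `¬ Addv`),
`hS24`/`hS24₂`, `hPT`, and `HPortDefect` = on every tower row additive at `3`, at every lattice-optimal
datum at the conductor on a defect row (`3 ∣ c₃ ∨ #E(ℚ₃)[3] ≠ 1 ∨ 3 ∣ c_P`), for all `v₃ ∣ 3`, `η`, SOME
exponent `e` with witnesses `KatoKuriharaWitnessAt W k e …` at every pinned `η`-canonical datum (Kim AJM
148 Thm. 3.13's dictionary at an additive `3`, lattice-index-free — NOT in print at `3`).  The case split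
is the registered skeleton's (`by_cases Addv`; the Kato-stratum exclusion turns into the defect
disjunction on the additive side). [cite: Wuthrich2014, Prop. 21 (p. 399)] [cite: Kim2025RefinedTNC, Thm 1.1]
[cite: Kim2022StructureSelmer, Thm. 3.13 and Conj. 1.10 (PDF p. 8)] [cite: Sakamoto2024, Thm. 4.4 (1)(2) (p. 926)] -/
theorem deepUpperAtThreeOffKatoStratum_of_wuthrich_of_portFamily (hW : Wuthrich2014.sha_dvd_analyticSha)
    (hGZK : rank_eq_analyticRank_of_analyticRank_le_one) (hmod : hasEntireLFunction_rat)
    (hDD : ∀ (W₀ : WeierstrassCurve ℚ) [W₀.IsElliptic] [W₀.IsGloballyMinimal],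
      (∀ n : ℕ, W₀.HasSurjectiveModNGaloisRep (3 ^ n : ℕ)) → Finite W₀.sha →
      ∀ {N : ℕ} [NeZero N], N = W₀.conductorNorm ℤ →
      ∀ (D₀ : ModularParametrizationData W₀ N),
        (∀ z ∈ D₀.L.lattice, ∃ w ∈ periodLattice D₀.f, z = D₀.c * w) →
        (∀ (W₂ : WeierstrassCurve ℚ) [W₂.IsElliptic] (D₂ : ModularParametrizationData W₂ N),
          D₂.f = D₀.f → D₀.modularDegree ≤ D₂.modularDegree) →
        (∀ r : ℚ, ratPlusSymbol D₀.f r ≠ 0 → 0 ≤ padicValRat 3 (ratPlusSymbol D₀.f r)) →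
        kuriharaVanishingOrder W₀ 3 D₀.f = 0 →
        ¬ (haveI : Fact (Nat.Prime 3) := ⟨Nat.prime_three⟩; Addv W₀ 3) →
        kuriharaPartialDeepInfty W₀ 3 D₀.f ≤ ((padicValNat 3 W₀.tamagawaProduct : ℕ) : ℕ∞))
    (hS24 : Sakamoto2024.kolyvaginSystems_freeRankOne_zmod_three_pow)
    (hS24₂ : Sakamoto2024.kolyvaginSystems_idealOfBasis_eq_fittingIdeal_zmod_three_pow)
    (hPT : poitouTate_selmerStructure_duality ℚ)
    (HPortDefect : ∀ (W : WeierstrassCurve ℚ) [W.IsElliptic] [W.IsGloballyMinimal],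
      (∀ m : ℕ, W.HasSurjectiveModNGaloisRep (3 ^ m : ℕ)) →
      (haveI : Fact (Nat.Prime 3) := ⟨Nat.prime_three⟩; Addv W 3) →
      ∀ (v₃ : HeightOneSpectrum (𝓞 ℚ)), ((3 : ℕ) : 𝓞 ℚ) ∈ v₃.asIdeal →
      ∀ (η : (q : HeightOneSpectrum (𝓞 ℚ)) → (ZMod (Ideal.absNorm q.asIdeal))ˣ),
        (∀ q, Subgroup.zpowers (η q) = ⊤) →
      ∀ {N : ℕ} [NeZero N] (P : ModularParametrizationData W N), N = W.conductorNorm ℤ →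
        (∀ z ∈ P.L.lattice, ∃ w ∈ periodLattice P.f, z = P.c * w) →
        (3 ∣ (W.baseChange ℚ_[3]).localTamagawaNumber ℤ_[3] ∨
          Nat.card {Q : (W.baseChange ℚ_[3]).toAffine.Point // (3 : ℕ) • Q = 0} ≠ 1 ∨
          (3 : ℤ) ∣ P.maninConstant) →
        ∃ e : ℕ, ∀ (k : ℕ)
          (Dk : KolyvaginDatum (W.torsionGaloisModule (((3 : ℕ) : ℤ) ^ k * ((3 : ℕ) : ℤ)))),
          Dk.IsCanonicalTauDatumThreeAtWith W k k η →
          ∃ (κ : Finset (HeightOneSpectrum (𝓞 ℚ)) →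
                galoisCohomology (W.torsionGaloisModule (((3 : ℕ) : ℤ) ^ k * ((3 : ℕ) : ℤ))) 1)
            (Λ : galoisCohomology ((W.torsionGaloisModule (((3 : ℕ) : ℤ) ^ k * ((3 : ℕ) : ℤ))).toLocal
                (Sum.inr v₃)) 1 →+ ZMod (3 ^ (k + 1)))
            (κ' : Finset (HeightOneSpectrum (𝓞 ℚ)) →
                galoisCohomology (W.torsionGaloisModule (((3 : ℕ) : ℤ) ^ k * ((3 : ℕ) : ℤ))) 1),
            KatoKuriharaWitnessAt W k e Dk v₃ P κ Λ κ') :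
    DeepUpperAtThreeOffKatoStratum := by
  intro W₀ _ _ htow hfin N _ hN D₀ hopt hdeg hint hord hoff
  by_cases hA : (haveI : Fact (Nat.Prime 3) := ⟨Nat.prime_three⟩; Addv W₀ 3)
  · have hdef : 3 ∣ (W₀.baseChange ℚ_[3]).localTamagawaNumber ℤ_[3] ∨
        Nat.card {Q : (W₀.baseChange ℚ_[3]).toAffine.Point // (3 : ℕ) • Q = 0} ≠ 1 ∨
        (3 : ℤ) ∣ D₀.maninConstant := by
      by_contra hcon
      push Not at hcon
      exact hoff ⟨hA, hcon.1, hcon.2.1, hcon.2.2⟩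
    exact stub_additiveDefect_of_facts_of_portFamily hS24 hS24₂ hGZK hPT HPortDefect W₀ htow hfin hN D₀ hopt
      hdeg hint hord hA hdef
  · exact stub_nonAdditive_of_wuthrich_of_deepInfty_le_tamagawa hW hGZK hmod W₀ htow hfin hN D₀ hopt hdeg
      hint hord hA (hDD W₀ htow hfin hN D₀ hopt hdeg hint hord hA)

/-- ★ **The same with the DEEP-keyed port family** (`HPortDefectDeep`: the port chooses its depth shift
`t` and exponent `e`, the data are `η`-canonical with primes in the class of depth `k + t` — n1011's (B6)
convention, honest on `E(ℚ₃)[3] ≠ 0` rows), at the price of the two S24-DEEP facts.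
[cite: Wuthrich2014, Prop. 21 (p. 399)] [cite: Kim2025RefinedTNC, Thm 1.1] [cite: Kim2022StructureSelmer, Thm. 3.13 and §2.2.2]
[cite: Sakamoto2024, Thm. 4.4 (1)(2) (p. 926)] -/
theorem deepUpperAtThreeOffKatoStratum_of_wuthrich_of_deepPortFamily (hW : Wuthrich2014.sha_dvd_analyticSha)
    (hGZK : rank_eq_analyticRank_of_analyticRank_le_one) (hmod : hasEntireLFunction_rat)
    (hDD : ∀ (W₀ : WeierstrassCurve ℚ) [W₀.IsElliptic] [W₀.IsGloballyMinimal],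
      (∀ n : ℕ, W₀.HasSurjectiveModNGaloisRep (3 ^ n : ℕ)) → Finite W₀.sha →
      ∀ {N : ℕ} [NeZero N], N = W₀.conductorNorm ℤ →
      ∀ (D₀ : ModularParametrizationData W₀ N),
        (∀ z ∈ D₀.L.lattice, ∃ w ∈ periodLattice D₀.f, z = D₀.c * w) →
        (∀ (W₂ : WeierstrassCurve ℚ) [W₂.IsElliptic] (D₂ : ModularParametrizationData W₂ N),
          D₂.f = D₀.f → D₀.modularDegree ≤ D₂.modularDegree) →
        (∀ r : ℚ, ratPlusSymbol D₀.f r ≠ 0 → 0 ≤ padicValRat 3 (ratPlusSymbol D₀.f r)) →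
        kuriharaVanishingOrder W₀ 3 D₀.f = 0 →
        ¬ (haveI : Fact (Nat.Prime 3) := ⟨Nat.prime_three⟩; Addv W₀ 3) →
        kuriharaPartialDeepInfty W₀ 3 D₀.f ≤ ((padicValNat 3 W₀.tamagawaProduct : ℕ) : ℕ∞))
    (hS24d : S24Deep.kolyvaginSystems_freeRankOne_zmod_three_pow_deep)
    (hS24d₂ : S24Deep.kolyvaginSystems_idealOfBasis_eq_fittingIdeal_zmod_three_pow_deep)
    (hPT : poitouTate_selmerStructure_duality ℚ)
    (HPortDefectDeep : ∀ (W : WeierstrassCurve ℚ) [W.IsElliptic] [W.IsGloballyMinimal],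
      (∀ m : ℕ, W.HasSurjectiveModNGaloisRep (3 ^ m : ℕ)) →
      (haveI : Fact (Nat.Prime 3) := ⟨Nat.prime_three⟩; Addv W 3) →
      ∀ (v₃ : HeightOneSpectrum (𝓞 ℚ)), ((3 : ℕ) : 𝓞 ℚ) ∈ v₃.asIdeal →
      ∀ (η : (q : HeightOneSpectrum (𝓞 ℚ)) → (ZMod (Ideal.absNorm q.asIdeal))ˣ),
        (∀ q, Subgroup.zpowers (η q) = ⊤) →
      ∀ {N : ℕ} [NeZero N] (P : ModularParametrizationData W N), N = W.conductorNorm ℤ →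
        (∀ z ∈ P.L.lattice, ∃ w ∈ periodLattice P.f, z = P.c * w) →
        (3 ∣ (W.baseChange ℚ_[3]).localTamagawaNumber ℤ_[3] ∨
          Nat.card {Q : (W.baseChange ℚ_[3]).toAffine.Point // (3 : ℕ) • Q = 0} ≠ 1 ∨
          (3 : ℤ) ∣ P.maninConstant) →
        ∃ t e : ℕ, ∀ (k : ℕ)
          (Dk : KolyvaginDatum (W.torsionGaloisModule (((3 : ℕ) : ℤ) ^ k * ((3 : ℕ) : ℤ)))),
          Dk.IsCanonicalTauDatumThreeAtWith W (k + t) k η →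
          ∃ (κ : Finset (HeightOneSpectrum (𝓞 ℚ)) →
                galoisCohomology (W.torsionGaloisModule (((3 : ℕ) : ℤ) ^ k * ((3 : ℕ) : ℤ))) 1)
            (Λ : galoisCohomology ((W.torsionGaloisModule (((3 : ℕ) : ℤ) ^ k * ((3 : ℕ) : ℤ))).toLocal
                (Sum.inr v₃)) 1 →+ ZMod (3 ^ (k + 1)))
            (κ' : Finset (HeightOneSpectrum (𝓞 ℚ)) →
                galoisCohomology (W.torsionGaloisModule (((3 : ℕ) : ℤ) ^ k * ((3 : ℕ) : ℤ))) 1),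
            KatoKuriharaWitnessAt W k e Dk v₃ P κ Λ κ') :
    DeepUpperAtThreeOffKatoStratum := by
  intro W₀ _ _ htow hfin N _ hN D₀ hopt hdeg hint hord hoff
  by_cases hA : (haveI : Fact (Nat.Prime 3) := ⟨Nat.prime_three⟩; Addv W₀ 3)
  · have hdef : 3 ∣ (W₀.baseChange ℚ_[3]).localTamagawaNumber ℤ_[3] ∨
        Nat.card {Q : (W₀.baseChange ℚ_[3]).toAffine.Point // (3 : ℕ) • Q = 0} ≠ 1 ∨
        (3 : ℤ) ∣ D₀.maninConstant := by
      by_contra hcon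
      push Not at hcon
      exact hoff ⟨hA, hcon.1, hcon.2.1, hcon.2.2⟩
    exact stub_additiveDefect_of_deepFacts_of_portFamily hS24d hS24d₂ hGZK hPT HPortDefectDeep W₀ htow hfin hN
      D₀ hopt hdeg hint hord hA hdef
  · exact stub_nonAdditive_of_wuthrich_of_deepInfty_le_tamagawa hW hGZK hmod W₀ htow hfin hN D₀ hopt hdeg
      hint hord hA (hDD W₀ htow hfin hN D₀ hopt hdeg hint hord hA)

/-! ## §2 Keyed at the registered two-exponent PORT₂ (`KimAtThreeKolyvaginDefs.KatoKuriharaPortThreeAtWith₂TwoExp`) -/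

/-- **PORT₂ ⟹ the deep-keyed free-exponent port at `(t, t)`.**  For `W` ADDITIVE at `3` with `ρ̄_{E,3}`
onto, `#E(ℚ₃)[3] = 3^t`, `v₃ ∣ 3` and a datum `P`, acc6's registered two-exponent port
`KatoKuriharaPortThreeAtWith₂TwoExp W t e v₃ η P` (value law `3^e·Λ(loc κ_d) = u·3^t·δ̃_{n(d)}`; NO
`3 ∤ c₃` / `3 ∤ c_P` / period antecedent) yields, at every `η`-canonical datum with primes in the class of
depth `k + t`, one-exponent witnesses `KatoKuriharaWitnessAt W k t Dk v₃ P (3^e•κ) Λ (3^e•κ′)` — call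
PORT₂ at `k = k′` with the pinned reduction and SCALE (`katoKuriharaWitnessAt_smul_of_twoExponent`).
[cite: Kim2022StructureSelmer, Thm. 3.13, Rem. 3.8 and Lemma 3.10] [cite: Kato2004Asterisque, Thm. 12.5 (1)] -/
theorem portEDeep_of_portTwoExp
    (W : WeierstrassCurve ℚ) [W.IsElliptic] [W.IsGloballyMinimal] (t e : ℕ)
    (hadd : haveI : Fact (Nat.Prime 3) := ⟨Nat.prime_three⟩; Addv W 3)
    (hsurj : W.HasSurjectiveModNGaloisRep ((3 : ℕ) : ℤ))
    (ht : Nat.card {Q : (W.baseChange ℚ_[3]).toAffine.Point // (3 : ℕ) • Q = 0} = 3 ^ t)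
    {N : ℕ} [NeZero N] (P : ModularParametrizationData W N)
    (v₃ : HeightOneSpectrum (𝓞 ℚ)) (hv₃ : ((3 : ℕ) : 𝓞 ℚ) ∈ v₃.asIdeal)
    (η : (q : HeightOneSpectrum (𝓞 ℚ)) → (ZMod (Ideal.absNorm q.asIdeal))ˣ)
    (hPort : KatoKuriharaPortThreeAtWith₂TwoExp W t e v₃ η P) :
    ∀ (k : ℕ) (Dk : KolyvaginDatum (W.torsionGaloisModule (((3 : ℕ) : ℤ) ^ k * ((3 : ℕ) : ℤ)))),
      Dk.IsCanonicalTauDatumThreeAtWith W (k + t) k η →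
      ∃ (κ : Finset (HeightOneSpectrum (𝓞 ℚ)) →
            galoisCohomology (W.torsionGaloisModule (((3 : ℕ) : ℤ) ^ k * ((3 : ℕ) : ℤ))) 1)
        (Λ : galoisCohomology ((W.torsionGaloisModule (((3 : ℕ) : ℤ) ^ k * ((3 : ℕ) : ℤ))).toLocal
            (Sum.inr v₃)) 1 →+ ZMod (3 ^ (k + 1)))
        (κ' : Finset (HeightOneSpectrum (𝓞 ℚ)) →
            galoisCohomology (W.torsionGaloisModule (((3 : ℕ) : ℤ) ^ k * ((3 : ℕ) : ℤ))) 1),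
        KatoKuriharaWitnessAt W k t Dk v₃ P κ Λ κ' := by
  haveI : Fact (Nat.Prime 3) := ⟨Nat.prime_three⟩
  intro k Dk hDk
  obtain ⟨red, hred⟩ := exists_torsionReduction_three W k k
  obtain ⟨κ, Λ, κ', -, -, -, hW, -, -⟩ := hPort k k Dk Dk red hDk hDk le_rfl hred hadd hsurj ht hv₃
  obtain ⟨h0, ⟨hKS, hbr⟩, hon, hker, hdict⟩ := hW
  refine ⟨_, Λ, _, katoKuriharaWitnessAt_smul_of_twoExponent W k e t Dk v₃ P κ Λ κ' h0 hKS hbr hon hker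
    fun d hd => ?_⟩
  obtain ⟨u, ψ, hψ, hL⟩ := hdict d hd
  refine ⟨u, ψ, hψ, ?_⟩
  push_cast at hL ⊢
  exact hL

/-- ★ **The registered stub `stub_additiveDefect` of crux 19562 VERBATIM as conclusion, KEYED AT PORT₂:**
⟸ S24-DEEP ×2, GZK, Poitou–Tate and `HPort₂` = on every tower row additive at `3`, at every
lattice-optimal datum `P` at the conductor on a defect row, for all `v₃ ∣ 3` and generator families `η`:
SOME `t e` with `#E(ℚ₃)[3] = 3^t` and acc6's `KatoKuriharaPortThreeAtWith₂TwoExp W t e v₃ η P` (in print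
`e = v₃(c₃) + v₃(c_P)`; FLAG `K22-Thm3.13-PORT@3`, NOT in print at `3`) — ONE registered predicate for
the additive-defect rows of 19562 / 19599 / 19679. [cite: Kim2025RefinedTNC, Thm 1.1]
[cite: Kim2022StructureSelmer, Thm. 3.13, Rem. 3.8 and §2.2.2] [cite: Sakamoto2024, Thm. 4.4 (1)(2) (p. 926)] -/
theorem stub_additiveDefect_of_deepFacts_of_portTwoExp
    (hS24d : S24Deep.kolyvaginSystems_freeRankOne_zmod_three_pow_deep)
    (hS24d₂ : S24Deep.kolyvaginSystems_idealOfBasis_eq_fittingIdeal_zmod_three_pow_deep)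
    (hGZK : rank_eq_analyticRank_of_analyticRank_le_one)
    (hPT : poitouTate_selmerStructure_duality ℚ)
    (HPort₂ : ∀ (W : WeierstrassCurve ℚ) [W.IsElliptic] [W.IsGloballyMinimal],
      (∀ m : ℕ, W.HasSurjectiveModNGaloisRep (3 ^ m : ℕ)) →
      (haveI : Fact (Nat.Prime 3) := ⟨Nat.prime_three⟩; Addv W 3) →
      ∀ (v₃ : HeightOneSpectrum (𝓞 ℚ)), ((3 : ℕ) : 𝓞 ℚ) ∈ v₃.asIdeal →
      ∀ (η : (q : HeightOneSpectrum (𝓞 ℚ)) → (ZMod (Ideal.absNorm q.asIdeal))ˣ),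
        (∀ q, Subgroup.zpowers (η q) = ⊤) →
      ∀ {N : ℕ} [NeZero N] (P : ModularParametrizationData W N), N = W.conductorNorm ℤ →
        (∀ z ∈ P.L.lattice, ∃ w ∈ periodLattice P.f, z = P.c * w) →
        (3 ∣ (W.baseChange ℚ_[3]).localTamagawaNumber ℤ_[3] ∨
          Nat.card {Q : (W.baseChange ℚ_[3]).toAffine.Point // (3 : ℕ) • Q = 0} ≠ 1 ∨
          (3 : ℤ) ∣ P.maninConstant) →
        ∃ t e : ℕ, Nat.card {Q : (W.baseChange ℚ_[3]).toAffine.Point // (3 : ℕ) • Q = 0} = 3 ^ t ∧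
          KatoKuriharaPortThreeAtWith₂TwoExp W t e v₃ η P) :
    ∀ (W₀ : WeierstrassCurve ℚ) [W₀.IsElliptic] [W₀.IsGloballyMinimal],
      (∀ n : ℕ, W₀.HasSurjectiveModNGaloisRep (3 ^ n : ℕ)) → Finite W₀.sha →
      ∀ {N : ℕ} [NeZero N], N = W₀.conductorNorm ℤ →
      ∀ (D₀ : Literature.NumberTheory.EllipticCurves.ModularForms.ModularParametrizationData W₀ N),
        (∀ z ∈ D₀.L.lattice, ∃ w ∈ Literature.NumberTheory.EllipticCurves.ModularForms.periodLattice D₀.f, z = D₀.c * w) →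
        (∀ (W₂ : WeierstrassCurve ℚ) [W₂.IsElliptic]
          (D₂ : Literature.NumberTheory.EllipticCurves.ModularForms.ModularParametrizationData W₂ N),
          D₂.f = D₀.f → D₀.modularDegree ≤ D₂.modularDegree) →
        (∀ r : ℚ, Literature.NumberTheory.EllipticCurves.ratPlusSymbol D₀.f r ≠ 0 →
          0 ≤ padicValRat 3 (Literature.NumberTheory.EllipticCurves.ratPlusSymbol D₀.f r)) →
        Literature.NumberTheory.EllipticCurves.kuriharaVanishingOrder W₀ 3 D₀.f = 0 →
        (haveI : Fact (Nat.Prime 3) := ⟨Nat.prime_three⟩;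
            Literature.NumberTheory.EllipticCurves.Rank1Residual.Addv W₀ 3) →
        (3 ∣ (W₀.baseChange ℚ_[3]).localTamagawaNumber ℤ_[3] ∨
          Nat.card {Q : (W₀.baseChange ℚ_[3]).toAffine.Point // (3 : ℕ) • Q = 0} ≠ 1 ∨
          (3 : ℤ) ∣ D₀.maninConstant) →
        ∃ d : ℕ, Literature.NumberTheory.EllipticCurves.kuriharaPartialDeepInfty W₀ 3 D₀.f = d ∧
          ((padicValNat 3 (Nat.card (AddCommGroup.primaryComponent W₀.sha 3)) + d : ℕ) : ℕ∞) ≤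
            Literature.NumberTheory.EllipticCurves.kuriharaPartial W₀ 3 D₀.f 0 := by
  refine stub_additiveDefect_of_deepFacts_of_portFamily hS24d hS24d₂ hGZK hPT ?_
  intro W _ _ htow hA v₃ hv₃ η hη N _ P hN hopt hdef
  haveI : Fact (Nat.Prime 3) := ⟨Nat.prime_three⟩
  obtain ⟨t, e, ht, hPort⟩ := HPort₂ W htow hA v₃ hv₃ η hη P hN hopt hdef
  have hsurj : W.HasSurjectiveModNGaloisRep ((3 : ℕ) : ℤ) := by simpa using htow 1
  exact ⟨t, t, portEDeep_of_portTwoExp W t e hA hsurj ht P v₃ hv₃ η hPort⟩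

/-- ★ **Crux `DeepUpperAtThreeOffKatoStratum` (19562) BY NAME, the additive rows KEYED AT PORT₂:** ⟸
Wuthrich 2014 Prop. 21, GZK, modularity, (DD) displayed on the NON-additive rows only, S24-DEEP ×2,
Poitou–Tate, and `HPort₂` (acc6's registered `KatoKuriharaPortThreeAtWith₂TwoExp` on the additive-defect
rows, `∃ t e`). [cite: Wuthrich2014, Prop. 21 (p. 399)] [cite: Kim2025RefinedTNC, Thm 1.1]
[cite: Kim2022StructureSelmer, Thm. 3.13, Rem. 3.8, Conj. 1.10 (PDF p. 8)] [cite: Sakamoto2024, Thm. 4.4 (1)(2) (p. 926)] -/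
theorem deepUpperAtThreeOffKatoStratum_of_wuthrich_of_portTwoExp (hW : Wuthrich2014.sha_dvd_analyticSha)
    (hGZK : rank_eq_analyticRank_of_analyticRank_le_one) (hmod : hasEntireLFunction_rat)
    (hDD : ∀ (W₀ : WeierstrassCurve ℚ) [W₀.IsElliptic] [W₀.IsGloballyMinimal],
      (∀ n : ℕ, W₀.HasSurjectiveModNGaloisRep (3 ^ n : ℕ)) → Finite W₀.sha →
      ∀ {N : ℕ} [NeZero N], N = W₀.conductorNorm ℤ →
      ∀ (D₀ : ModularParametrizationData W₀ N),
        (∀ z ∈ D₀.L.lattice, ∃ w ∈ periodLattice D₀.f, z = D₀.c * w) →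
        (∀ (W₂ : WeierstrassCurve ℚ) [W₂.IsElliptic] (D₂ : ModularParametrizationData W₂ N),
          D₂.f = D₀.f → D₀.modularDegree ≤ D₂.modularDegree) →
        (∀ r : ℚ, ratPlusSymbol D₀.f r ≠ 0 → 0 ≤ padicValRat 3 (ratPlusSymbol D₀.f r)) →
        kuriharaVanishingOrder W₀ 3 D₀.f = 0 →
        ¬ (haveI : Fact (Nat.Prime 3) := ⟨Nat.prime_three⟩; Addv W₀ 3) →
        kuriharaPartialDeepInfty W₀ 3 D₀.f ≤ ((padicValNat 3 W₀.tamagawaProduct : ℕ) : ℕ∞))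
    (hS24d : S24Deep.kolyvaginSystems_freeRankOne_zmod_three_pow_deep)
    (hS24d₂ : S24Deep.kolyvaginSystems_idealOfBasis_eq_fittingIdeal_zmod_three_pow_deep)
    (hPT : poitouTate_selmerStructure_duality ℚ)
    (HPort₂ : ∀ (W : WeierstrassCurve ℚ) [W.IsElliptic] [W.IsGloballyMinimal],
      (∀ m : ℕ, W.HasSurjectiveModNGaloisRep (3 ^ m : ℕ)) →
      (haveI : Fact (Nat.Prime 3) := ⟨Nat.prime_three⟩; Addv W 3) →
      ∀ (v₃ : HeightOneSpectrum (𝓞 ℚ)), ((3 : ℕ) : 𝓞 ℚ) ∈ v₃.asIdeal →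
      ∀ (η : (q : HeightOneSpectrum (𝓞 ℚ)) → (ZMod (Ideal.absNorm q.asIdeal))ˣ),
        (∀ q, Subgroup.zpowers (η q) = ⊤) →
      ∀ {N : ℕ} [NeZero N] (P : ModularParametrizationData W N), N = W.conductorNorm ℤ →
        (∀ z ∈ P.L.lattice, ∃ w ∈ periodLattice P.f, z = P.c * w) →
        (3 ∣ (W.baseChange ℚ_[3]).localTamagawaNumber ℤ_[3] ∨
          Nat.card {Q : (W.baseChange ℚ_[3]).toAffine.Point // (3 : ℕ) • Q = 0} ≠ 1 ∨
          (3 : ℤ) ∣ P.maninConstant) →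
        ∃ t e : ℕ, Nat.card {Q : (W.baseChange ℚ_[3]).toAffine.Point // (3 : ℕ) • Q = 0} = 3 ^ t ∧
          KatoKuriharaPortThreeAtWith₂TwoExp W t e v₃ η P) :
    DeepUpperAtThreeOffKatoStratum := by
  refine deepUpperAtThreeOffKatoStratum_of_wuthrich_of_deepPortFamily hW hGZK hmod hDD hS24d hS24d₂ hPT ?_
  intro W _ _ htow hA v₃ hv₃ η hη N _ P hN hopt hdef
  haveI : Fact (Nat.Prime 3) := ⟨Nat.prime_three⟩
  obtain ⟨t, e, ht, hPort⟩ := HPort₂ W htow hA v₃ hv₃ η hη P hN hopt hdef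
  have hsurj : W.HasSurjectiveModNGaloisRep ((3 : ℕ) : ℤ) := by simpa using htow 1
  exact ⟨t, t, portEDeep_of_portTwoExp W t e hA hsurj ht P v₃ hv₃ η hPort⟩

end Summit.BirchSwinnertonDyer.BirchSwinnertonDyer.Theorems.KimAtThreeDeepUpperOffStratumOfPortFamily

end
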